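import Summits.CriticalPhenomena.SAWScalingLimit.Theorems.SAWTotalPositivityBoundaryTP2Defs
import Summits.CriticalPhenomena.SAWScalingLimit.Theorems.SAWTotalPositivityBoundaryTP2Kernel
import Summits.CriticalPhenomena.SAWScalingLimit.Theorems.SAWTotalPositivityBoundaryTP2Symmetry
import Summits.CriticalPhenomena.SAWScalingLimit.Theorems.SAWTotalPositivityBoundaryTP2LadderKernelsInterior
import Summits.CriticalPhenomena.SAWScalingLimit.Theorems.EdgeOfPositivity.Negative.EdgeOfPositivityRectDomain
import HarnessLib

/-!
# Crux `BoundaryTP2` (stmt-CriticalPhenomena-7115), line `Sketch`: two bottom sites of a ladder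
between two top sites, crossing pairing vs nested pairing

Tool stub `stub_ladder_bbtt_nested4` of the line's skeleton: on the ladder
`R_L = discreteDomainGraph (rectDomain L 1) 1` (sites `{0..L} × {0,1}`), for the boundary quadruple
`(c₁,0), (c₂,0)` on the bottom row and `(d₁,1), (d₂,1)` on the top row with
`d₂ < c₁ < c₂ < d₁ ≤ L` (both bottom columns between the top ones; cyclic order
`(c₁,0),(c₂,0),(d₁,1),(d₂,1)`) and `0 ≤ x ≤ 1/2`, the crossing pairing weighs at most the nested
one:

  `Z((c₁,0),(d₁,1)) Z((c₂,0),(d₂,1)) ≤ Z((c₁,0),(d₂,1)) Z((c₂,0),(d₁,1))`,  `Z = pathKernel R_L x`.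

Proof. All four kernels join opposite rows. By `stub_ladderKernels_interior` (after
`pathKernel_comm` for the two kernels whose left column `d₂` is written second) each has the
rank-two form `Z = x^{n+1}/2 · (a_i b_j P^n - a'_i b'_j M^n)` for left column `i`, right column
`j = i + n + 1`, with `P = 1+x`, `M = 1-x`, `a_i = P + E_i`, `a'_i = M - E_i`, `b_j = P + E_{L-j}`,
`b'_j = M - E_{L-j}`, `E_k = Σ_{d<k} x^{2d+3}` (`ladderN4_kernel_cross01/10`). Since
`E_k (1-x²) ≤ x³`, `0 ≤ E_k ≤ 1/6` on `[0, 1/2]`, so `a', b' ≥ 0`, `a' P ≤ a M`, `b' P ≤ b M`,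
`M^n ≤ P^n`; hence a bracket `D = a b P^n - a' b' M^n` satisfies `D ≤ a b P^n` and
`4x · a b P^n ≤ D P²`. Bounding the two crossing kernels above and the two nested kernels below,
with spans `c₁ - d₂ = p+1`, `c₂ - c₁ = m+1`, `d₁ - c₂ = q+1`, the claim (times `P⁴`) reduces to
`x^{2m+2} P^{2m+6} a_{c₁} b_{c₂} ≤ 16 x² a_{c₂} b_{c₁}`, which follows from `a_{c₁} ≤ a_{c₂}`,
`b_{c₂} ≤ b_{c₁}` (`E_k` is monotone in `k`) and the scalar bound `(xP)^{2m} P⁶ ≤ (3/2)⁶ ≤ 16`.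
-/

noncomputable section

namespace Summit.CriticalPhenomena.SAWScalingLimit.Theorems.BoundaryTP2

open Literature.Probability.LatticeModels Literature.Probability.RandomPlanarGeometry
open Summit.CriticalPhenomena.SAWScalingLimit.Theorems.EdgeOfPositivity.Negative
open scoped ENNReal

/-! ## The excursion sums `E_k = Σ_{d<k} x^{2d+3}` -/

-- adapted from `…BoundaryTP2LadderBbbtAdjacent` (`ladderBbbt_E_*`)

/-- `E_k ≥ 0` for `x ≥ 0`. [folklore] -/
private theorem ladderN4_E_nonneg {x : ℝ} (hx : 0 ≤ x) (k : ℕ) :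
    0 ≤ ∑ d ∈ Finset.range k, x ^ (2 * d + 3) :=
  Finset.sum_nonneg fun _ _ => pow_nonneg hx _

/-- Telescoping: `E_k (1 - x²) + x^{2k+3} = x³`. [folklore] -/
private theorem ladderN4_E_telescope (x : ℝ) (k : ℕ) :
    (∑ d ∈ Finset.range k, x ^ (2 * d + 3)) * (1 - x ^ 2) + x ^ (2 * k + 3) = x ^ 3 := by
  induction k with
  | zero => simp
  | succ k ih =>
    rw [Finset.sum_range_succ]
    linear_combination ih

/-- Powers of `x ∈ [0, 1/2]` are at most the powers of `1/2`. [folklore] -/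
private theorem ladderN4_pow_le {x : ℝ} (hx0 : 0 ≤ x) (hx : x ≤ 1 / 2) (n : ℕ) :
    x ^ n ≤ (1 / 2) ^ n :=
  pow_le_pow_left₀ hx0 hx n

/-- `E_k ≤ 1/6` for `0 ≤ x ≤ 1/2` (from `E_k (1 - x²) ≤ x³ ≤ 1/8` and `1 - x² ≥ 3/4`).
[folklore] -/
private theorem ladderN4_E_le {x : ℝ} (hx0 : 0 ≤ x) (hx : x ≤ 1 / 2) (k : ℕ) :
    ∑ d ∈ Finset.range k, x ^ (2 * d + 3) ≤ 1 / 6 := by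
  have h := ladderN4_E_telescope x k
  have hE := ladderN4_E_nonneg hx0 k
  have hk : 0 ≤ x ^ (2 * k + 3) := pow_nonneg hx0 _
  have hx2 := ladderN4_pow_le hx0 hx 2
  have hx3 := ladderN4_pow_le hx0 hx 3
  norm_num at hx2 hx3
  nlinarith [mul_nonneg hE (by linarith : (0 : ℝ) ≤ 1 / 4 - x ^ 2)]

/-- `E_k` is monotone in `k` for `x ≥ 0`. [folklore] -/
private theorem ladderN4_E_mono {x : ℝ} (hx : 0 ≤ x) {k l : ℕ} (hkl : k ≤ l) :
    ∑ d ∈ Finset.range k, x ^ (2 * d + 3) ≤ ∑ d ∈ Finset.range l, x ^ (2 * d + 3) :=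
  Finset.sum_le_sum_of_subset_of_nonneg (Finset.range_mono hkl) fun _ _ _ => pow_nonneg hx _

/-! ## The rank-two form of the opposite-row ladder kernels -/

/-- Bottom-to-top kernels of the ladder `{0..L}×{0,1}` in rank-two form: for `i + n + 1 = j ≤ L`
and `x ≥ 0`, `Z_{R_L}((i,0),(j,1)) = x^{n+1}/2 · (a_i b_j (1+x)^n - a'_i b'_j (1-x)^n)` with
`a_i = 1+x+E_i`, `a'_i = 1-x-E_i`, `b_j = 1+x+E_{L-j}`, `b'_j = 1-x-E_{L-j}` (a regrouping of
`stub_ladderKernels_interior`, sign `ε = -1` for endpoints on different rows). [folklore] -/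
private theorem ladderN4_kernel_cross01 (L i j n : ℕ) (hn : i + n + 1 = j) (hjL : j ≤ L) {x : ℝ}
    (hx : 0 ≤ x) :
    pathKernel (discreteDomainGraph (rectDomain L 1) 1) x (st i 0) (st j 1) =
      ENNReal.ofReal (x ^ (n + 1) / 2 *
        ((1 + x + ∑ d ∈ Finset.range i, x ^ (2 * d + 3)) *
              (1 + x + ∑ d ∈ Finset.range (L - j), x ^ (2 * d + 3)) * (1 + x) ^ n -
          (1 - x - ∑ d ∈ Finset.range i, x ^ (2 * d + 3)) *
              (1 - x - ∑ d ∈ Finset.range (L - j), x ^ (2 * d + 3)) * (1 - x) ^ n)) := by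
  -- adapted from `ladderBbbt_kernel_mixed` in `…BoundaryTP2LadderBbbtAdjacent`
  rw [stub_ladderKernels_interior L i j (by omega) hjL hx 0 1 (Or.inl rfl) (Or.inr rfl),
    if_neg (by norm_num : (0 : ℤ) ≠ 1)]
  congr 1
  subst hn
  have e1 : i + n + 1 - i = n + 1 := by omega
  have e2 : n + 1 - 1 = n := rfl
  rw [e1, e2]
  ring

/-- Top-to-bottom kernels of the ladder `{0..L}×{0,1}` in rank-two form: for `i + n + 1 = j ≤ L`
and `x ≥ 0`, `Z_{R_L}((i,1),(j,0)) = x^{n+1}/2 · (a_i b_j (1+x)^n - a'_i b'_j (1-x)^n)`, the same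
real number as `Z_{R_L}((i,0),(j,1))` (the form depends on the rows only through `r ≠ s`).
[folklore] -/
private theorem ladderN4_kernel_cross10 (L i j n : ℕ) (hn : i + n + 1 = j) (hjL : j ≤ L) {x : ℝ}
    (hx : 0 ≤ x) :
    pathKernel (discreteDomainGraph (rectDomain L 1) 1) x (st i 1) (st j 0) =
      ENNReal.ofReal (x ^ (n + 1) / 2 *
        ((1 + x + ∑ d ∈ Finset.range i, x ^ (2 * d + 3)) *
              (1 + x + ∑ d ∈ Finset.range (L - j), x ^ (2 * d + 3)) * (1 + x) ^ n -
          (1 - x - ∑ d ∈ Finset.range i, x ^ (2 * d + 3)) *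
              (1 - x - ∑ d ∈ Finset.range (L - j), x ^ (2 * d + 3)) * (1 - x) ^ n)) := by
  rw [stub_ladderKernels_interior L i j (by omega) hjL hx 1 0 (Or.inr rfl) (Or.inl rfl),
    if_neg (by norm_num : (1 : ℤ) ≠ 0)]
  congr 1
  subst hn
  have e1 : i + n + 1 - i = n + 1 := by omega
  have e2 : n + 1 - 1 = n := rfl
  rw [e1, e2]
  ring

/-! ## Real inequalities in the rank-two variables -/

-- adapted from `…BoundaryTP2LadderBbbtAdjacent` (`ladderBbbt_diff_*`)

/-- The main part `a b (1+x)^k` of a bracket is nonnegative. [folklore] -/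
private theorem ladderN4_main_nonneg {x e f : ℝ} (k : ℕ) (hx0 : 0 ≤ x) (he : 0 ≤ e)
    (hf : 0 ≤ f) : 0 ≤ (1 + x + e) * (1 + x + f) * (1 + x) ^ k := by
  positivity

/-- Upper bound of an opposite-row bracket: `a b P^k - a' b' M^k ≤ a b P^k` (`a', b', M ≥ 0` for
`x ≤ 1/2`, `e, f ≤ 1/6`). [folklore] -/
private theorem ladderN4_diff_upper {x e f : ℝ} (k : ℕ) (hx : x ≤ 1 / 2) (he : e ≤ 1 / 6)
    (hf : f ≤ 1 / 6) :
    (1 + x + e) * (1 + x + f) * (1 + x) ^ k - (1 - x - e) * (1 - x - f) * (1 - x) ^ k ≤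
      (1 + x + e) * (1 + x + f) * (1 + x) ^ k :=
  sub_le_self _ (mul_nonneg (mul_nonneg (by linarith) (by linarith)) (pow_nonneg (by linarith) k))

/-- An opposite-row bracket is nonnegative: `a' b' M^k ≤ a b P^k` termwise (`a' ≤ a`,
`0 ≤ b' ≤ b`, `0 ≤ M ≤ P`). [folklore] -/
private theorem ladderN4_diff_nonneg {x e f : ℝ} (k : ℕ) (hx0 : 0 ≤ x) (hx : x ≤ 1 / 2)
    (he0 : 0 ≤ e) (hf0 : 0 ≤ f) (hf : f ≤ 1 / 6) :
    0 ≤ (1 + x + e) * (1 + x + f) * (1 + x) ^ k - (1 - x - e) * (1 - x - f) * (1 - x) ^ k :=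
  sub_nonneg.2
    (mul_le_mul (mul_le_mul (by linarith) (by linarith) (by linarith) (by linarith))
      (pow_le_pow_left₀ (by linarith) (by linarith) k) (pow_nonneg (by linarith) k)
      (mul_nonneg (by linarith) (by linarith)))

/-- The rank-two form of an opposite-row kernel is nonnegative. [folklore] -/
private theorem ladderN4_form_nonneg {x e f : ℝ} (k : ℕ) (hx0 : 0 ≤ x) (hx : x ≤ 1 / 2)
    (he0 : 0 ≤ e) (hf0 : 0 ≤ f) (hf : f ≤ 1 / 6) :
    0 ≤ x ^ (k + 1) / 2 *
      ((1 + x + e) * (1 + x + f) * (1 + x) ^ k - (1 - x - e) * (1 - x - f) * (1 - x) ^ k) :=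
  mul_nonneg (by positivity) (ladderN4_diff_nonneg k hx0 hx he0 hf0 hf)

/-- Lower bound of an opposite-row bracket: `4x · a b P^k ≤ (a b P^k - a' b' M^k) P²`, i.e.
`a' b' M^k P² ≤ a b P^k M²` (from `a' P ≤ a M`, `b' P ≤ b M`, `M^k ≤ P^k`) together with
`P² - M² = 4x`. [folklore] -/
private theorem ladderN4_diff_lower {x e f : ℝ} (k : ℕ) (hx0 : 0 ≤ x) (hx : x ≤ 1 / 2)
    (he0 : 0 ≤ e) (hf0 : 0 ≤ f) (hf : f ≤ 1 / 6) :
    4 * x * ((1 + x + e) * (1 + x + f) * (1 + x) ^ k) ≤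
      ((1 + x + e) * (1 + x + f) * (1 + x) ^ k - (1 - x - e) * (1 - x - f) * (1 - x) ^ k) *
        (1 + x) ^ 2 := by
  have h1 : (1 - x - e) * (1 + x) ≤ (1 + x + e) * (1 - x) := by nlinarith
  have h2 : (1 - x - f) * (1 + x) ≤ (1 + x + f) * (1 - x) := by nlinarith
  have h3 : (1 - x) ^ k ≤ (1 + x) ^ k := pow_le_pow_left₀ (by linarith) (by linarith) k
  have key : (1 - x - e) * (1 + x) * ((1 - x - f) * (1 + x)) * (1 - x) ^ k ≤
      (1 + x + e) * (1 - x) * ((1 + x + f) * (1 - x)) * (1 + x) ^ k :=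
    mul_le_mul (mul_le_mul h1 h2 (mul_nonneg (by linarith) (by linarith))
      (mul_nonneg (by linarith) (by linarith))) h3 (pow_nonneg (by linarith) k)
      (mul_nonneg (mul_nonneg (by linarith) (by linarith)) (mul_nonneg (by linarith) (by linarith)))
  nlinarith [key]

/-- The scalar inequality `x^{2m+2} (1+x)^{2m+2} (1+x)⁴ ≤ 16 x²` on `[0, 1/2]`
(`(x(1+x))^{2m} ≤ 1` as `x(1+x) ≤ 3/4`, and `(1+x)⁶ ≤ (3/2)⁶ = 729/64 ≤ 16`). [folklore] -/
private theorem ladderN4_scalar {x : ℝ} (m : ℕ) (hx0 : 0 ≤ x) (hx : x ≤ 1 / 2) :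
    x ^ (2 * m + 2) * (1 + x) ^ (2 * m + 2) * (1 + x) ^ 4 ≤ 16 * x ^ 2 := by
  have h0 : 0 ≤ x * (1 + x) := mul_nonneg hx0 (by linarith)
  have h1 : x * (1 + x) ≤ 1 := by nlinarith
  have hpow : (x * (1 + x)) ^ (2 * m) ≤ 1 := pow_le_one₀ h0 h1
  have hP6 : (1 + x) ^ 6 ≤ 16 := by
    have h6 : (1 + x) ^ 6 ≤ (3 / 2) ^ 6 := pow_le_pow_left₀ (by linarith) (by linarith) 6
    norm_num at h6
    linarith
  have e : x ^ (2 * m + 2) * (1 + x) ^ (2 * m + 2) * (1 + x) ^ 4 =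
      (x * (1 + x)) ^ (2 * m) * (x ^ 2 * (1 + x) ^ 6) := by
    rw [mul_pow]
    ring
  calc x ^ (2 * m + 2) * (1 + x) ^ (2 * m + 2) * (1 + x) ^ 4
      = (x * (1 + x)) ^ (2 * m) * (x ^ 2 * (1 + x) ^ 6) := e
    _ ≤ 1 * (x ^ 2 * 16) :=
        mul_le_mul hpow (mul_le_mul_of_nonneg_left hP6 (by positivity)) (by positivity)
          (by norm_num)
    _ = 16 * x ^ 2 := by ring

/-- The real inequality behind `stub_ladder_bbtt_nested4`, in the rank-two variables
`e₀ = E_{d₂}`, `e₁ = E_{c₁}`, `e₂ = E_{c₂}`, `f₁ = E_{L-c₁}`, `f₂ = E_{L-c₂}`, `f₃ = E_{L-d₁}`,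
spans `c₁ - d₂ = p+1`, `c₂ - c₁ = m+1`, `d₁ - c₂ = q+1`. [folklore] -/
private theorem ladderN4_real {x e₀ e₁ e₂ f₁ f₂ f₃ : ℝ} (p m q : ℕ) (hx0 : 0 ≤ x)
    (hx : x ≤ 1 / 2) (he₀ : 0 ≤ e₀) (he₀' : e₀ ≤ 1 / 6) (he₁ : 0 ≤ e₁) (he₁' : e₁ ≤ 1 / 6)
    (he₂ : 0 ≤ e₂) (hf₁ : 0 ≤ f₁) (hf₁' : f₁ ≤ 1 / 6) (hf₂ : 0 ≤ f₂) (hf₂' : f₂ ≤ 1 / 6)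
    (hf₃ : 0 ≤ f₃) (hf₃' : f₃ ≤ 1 / 6) (h₁₂ : e₁ ≤ e₂) (h₂₁ : f₂ ≤ f₁) :
    x ^ (m + q + 1 + 1) / 2 *
          ((1 + x + e₁) * (1 + x + f₃) * (1 + x) ^ (m + q + 1) -
            (1 - x - e₁) * (1 - x - f₃) * (1 - x) ^ (m + q + 1)) *
        (x ^ (p + m + 1 + 1) / 2 *
          ((1 + x + e₀) * (1 + x + f₂) * (1 + x) ^ (p + m + 1) -
            (1 - x - e₀) * (1 - x - f₂) * (1 - x) ^ (p + m + 1))) ≤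
      x ^ (p + 1) / 2 *
          ((1 + x + e₀) * (1 + x + f₁) * (1 + x) ^ p - (1 - x - e₀) * (1 - x - f₁) * (1 - x) ^ p) *
        (x ^ (q + 1) / 2 *
          ((1 + x + e₂) * (1 + x + f₃) * (1 + x) ^ q -
            (1 - x - e₂) * (1 - x - f₃) * (1 - x) ^ q)) := by
  have hP4 : 0 < (1 + x) ^ 4 := by positivity
  -- the two crossing brackets from above, the two nested brackets from below
  have U1 := ladderN4_diff_upper (m + q + 1) hx he₁' hf₃'
  have U2 := ladderN4_diff_upper (p + m + 1) hx he₀' hf₂'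
  have N2 := ladderN4_diff_nonneg (p + m + 1) hx0 hx he₀ hf₂ hf₂'
  have A1 := ladderN4_main_nonneg (m + q + 1) hx0 he₁ hf₃
  have L3 := ladderN4_diff_lower p hx0 hx he₀ hf₁ hf₁'
  have L4 := ladderN4_diff_lower q hx0 hx he₂ hf₃ hf₃'
  have A4 : 0 ≤ 4 * x * ((1 + x + e₂) * (1 + x + f₃) * (1 + x) ^ q) :=
    mul_nonneg (by positivity) (ladderN4_main_nonneg q hx0 he₂ hf₃)
  have D3 : 0 ≤ ((1 + x + e₀) * (1 + x + f₁) * (1 + x) ^ p -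
        (1 - x - e₀) * (1 - x - f₁) * (1 - x) ^ p) * (1 + x) ^ 2 :=
    mul_nonneg (ladderN4_diff_nonneg p hx0 hx he₀ hf₁ hf₁') (by positivity)
  -- the key comparison of the middle factors
  have hab : (1 + x + e₁) * (1 + x + f₂) ≤ (1 + x + e₂) * (1 + x + f₁) :=
    mul_le_mul (by linarith) (by linarith) (by linarith) (by linarith)
  have key : x ^ (2 * m + 2) * (1 + x) ^ (2 * m + 2) * (1 + x) ^ 4 *
        ((1 + x + e₁) * (1 + x + f₂)) ≤ 16 * x ^ 2 * ((1 + x + e₂) * (1 + x + f₁)) :=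
    mul_le_mul (ladderN4_scalar m hx0 hx) hab (by positivity) (by positivity)
  refine le_of_mul_le_mul_right ?_ hP4
  calc x ^ (m + q + 1 + 1) / 2 *
          ((1 + x + e₁) * (1 + x + f₃) * (1 + x) ^ (m + q + 1) -
            (1 - x - e₁) * (1 - x - f₃) * (1 - x) ^ (m + q + 1)) *
        (x ^ (p + m + 1 + 1) / 2 *
          ((1 + x + e₀) * (1 + x + f₂) * (1 + x) ^ (p + m + 1) -
            (1 - x - e₀) * (1 - x - f₂) * (1 - x) ^ (p + m + 1))) * (1 + x) ^ 4
      ≤ x ^ (m + q + 1 + 1) / 2 * ((1 + x + e₁) * (1 + x + f₃) * (1 + x) ^ (m + q + 1)) *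
          (x ^ (p + m + 1 + 1) / 2 * ((1 + x + e₀) * (1 + x + f₂) * (1 + x) ^ (p + m + 1))) *
          (1 + x) ^ 4 :=
        mul_le_mul_of_nonneg_right
          (mul_le_mul (mul_le_mul_of_nonneg_left U1 (by positivity))
            (mul_le_mul_of_nonneg_left U2 (by positivity)) (mul_nonneg (by positivity) N2)
            (mul_nonneg (by positivity) A1))
          (by positivity)
    _ = x ^ (p + 1) / 2 * (x ^ (q + 1) / 2) * ((1 + x + e₀) * (1 + x + f₃)) *
          ((1 + x) ^ p * (1 + x) ^ q) *
          (x ^ (2 * m + 2) * (1 + x) ^ (2 * m + 2) * (1 + x) ^ 4 *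
            ((1 + x + e₁) * (1 + x + f₂))) := by ring
    _ ≤ x ^ (p + 1) / 2 * (x ^ (q + 1) / 2) * ((1 + x + e₀) * (1 + x + f₃)) *
          ((1 + x) ^ p * (1 + x) ^ q) * (16 * x ^ 2 * ((1 + x + e₂) * (1 + x + f₁))) :=
        mul_le_mul_of_nonneg_left key (by positivity)
    _ = x ^ (p + 1) / 2 * (4 * x * ((1 + x + e₀) * (1 + x + f₁) * (1 + x) ^ p)) *
          (x ^ (q + 1) / 2 * (4 * x * ((1 + x + e₂) * (1 + x + f₃) * (1 + x) ^ q))) := by ring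
    _ ≤ x ^ (p + 1) / 2 *
          (((1 + x + e₀) * (1 + x + f₁) * (1 + x) ^ p -
              (1 - x - e₀) * (1 - x - f₁) * (1 - x) ^ p) * (1 + x) ^ 2) *
        (x ^ (q + 1) / 2 *
          (((1 + x + e₂) * (1 + x + f₃) * (1 + x) ^ q -
              (1 - x - e₂) * (1 - x - f₃) * (1 - x) ^ q) * (1 + x) ^ 2)) :=
        mul_le_mul (mul_le_mul_of_nonneg_left L3 (by positivity))
          (mul_le_mul_of_nonneg_left L4 (by positivity)) (mul_nonneg (by positivity) A4)
          (mul_nonneg (by positivity) D3)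
    _ = x ^ (p + 1) / 2 *
          ((1 + x + e₀) * (1 + x + f₁) * (1 + x) ^ p - (1 - x - e₀) * (1 - x - f₁) * (1 - x) ^ p) *
        (x ^ (q + 1) / 2 *
          ((1 + x + e₂) * (1 + x + f₃) * (1 + x) ^ q -
            (1 - x - e₂) * (1 - x - f₃) * (1 - x) ^ q)) * (1 + x) ^ 4 := by ring

/-! ## The stub -/

/-- **Tool stub `stub_ladder_bbtt_nested4`.** On the ladder `{0..L}×{0,1}`, for two bottom sites
`(c₁,0), (c₂,0)` between two top sites `(d₂,1), (d₁,1)` (`d₂ < c₁ < c₂ < d₁ ≤ L`, cyclic order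
`(c₁,0),(c₂,0),(d₁,1),(d₂,1)`) and `0 ≤ x ≤ 1/2`: the crossing pairing weighs at most the
NESTED one, `Z((c₁,0),(d₁,1)) Z((c₂,0),(d₂,1)) ≤ Z((c₁,0),(d₂,1)) Z((c₂,0),(d₁,1))`. Mechanism:
all four kernels join opposite rows; in their rank-two form (`ladderN4_kernel_cross01/10`) each
bracket `D = a b P^n - a' b' M^n` satisfies `4x · a b P^n ≤ D P² ≤ a b P^{n+2}`, the crossing
product of main parts carries the extra factor `(x(1+x))^{2(c₂-c₁)}`, and
`(x(1+x))^{2m} (1+x)⁶ ≤ 16` on `[0, 1/2]`; the end corrections `E_k` only help (`E` is monotone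
in `k`). [folklore] -/
theorem stub_ladder_bbtt_nested4 (L : ℕ) {c₁ c₂ d₂ d₁ : ℕ} (h₁ : d₂ < c₁) (h₂ : c₁ < c₂) (h₃ : c₂ < d₁)
    (h₄ : d₁ ≤ L) {x : ℝ} (hx0 : 0 ≤ x) (hx : x ≤ 1 / 2) :
    pathKernel (discreteDomainGraph (rectDomain L 1) 1) x (st c₁ 0) (st d₁ 1) *
        pathKernel (discreteDomainGraph (rectDomain L 1) 1) x (st c₂ 0) (st d₂ 1) ≤
      pathKernel (discreteDomainGraph (rectDomain L 1) 1) x (st c₁ 0) (st d₂ 1) *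
        pathKernel (discreteDomainGraph (rectDomain L 1) 1) x (st c₂ 0) (st d₁ 1) := by
  obtain ⟨p, hp⟩ : ∃ p, c₁ = d₂ + p + 1 := ⟨c₁ - d₂ - 1, by omega⟩
  obtain ⟨m, hm⟩ : ∃ m, c₂ = c₁ + m + 1 := ⟨c₂ - c₁ - 1, by omega⟩
  obtain ⟨q, hq⟩ : ∃ q, d₁ = c₂ + q + 1 := ⟨d₁ - c₂ - 1, by omega⟩
  have hE := fun k => ladderN4_E_nonneg hx0 k
  have hE' := fun k => ladderN4_E_le hx0 hx k
  rw [pathKernel_comm (discreteDomainGraph (rectDomain L 1) 1) x (st c₂ 0) (st d₂ 1),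
    pathKernel_comm (discreteDomainGraph (rectDomain L 1) 1) x (st c₁ 0) (st d₂ 1),
    ladderN4_kernel_cross01 L c₁ d₁ (m + q + 1) (by omega) h₄ hx0,
    ladderN4_kernel_cross10 L d₂ c₂ (p + m + 1) (by omega) (by omega) hx0,
    ladderN4_kernel_cross10 L d₂ c₁ p (by omega) (by omega) hx0,
    ladderN4_kernel_cross01 L c₂ d₁ q (by omega) h₄ hx0,
    ← ENNReal.ofReal_mul
      (ladderN4_form_nonneg (m + q + 1) hx0 hx (hE c₁) (hE (L - d₁)) (hE' (L - d₁))),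
    ← ENNReal.ofReal_mul (ladderN4_form_nonneg p hx0 hx (hE d₂) (hE (L - c₁)) (hE' (L - c₁)))]
  exact ENNReal.ofReal_le_ofReal (ladderN4_real p m q hx0 hx (hE d₂) (hE' d₂) (hE c₁) (hE' c₁)
    (hE c₂) (hE (L - c₁)) (hE' (L - c₁)) (hE (L - c₂)) (hE' (L - c₂)) (hE (L - d₁)) (hE' (L - d₁))
    (ladderN4_E_mono hx0 (by omega : c₁ ≤ c₂)) (ladderN4_E_mono hx0 (by omega : L - c₂ ≤ L - c₁)))

end Summit.CriticalPhenomena.SAWScalingLimit.Theorems.BoundaryTP2
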